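import Mathlib

/-!
# The dictionary line — finite identities behind DERIVATIONS_engineB §69 (ENGINE B, pub-hlocus abs-2 g51) — helper anchor

certified instances and evidence bearing on the general Hodge conjecture; no claim.

§69 derives the census ↔ isomorphism-count dictionary `Isom_{A/μⁿ}(E,E′) = {γ ∈ O_B^× : v_P(γ μ̃_E γ⁻¹ − μ̃_{E′}) ≥ n}`
for CM curves ramified at `3` from printed inputs (Gross–Zagier Prop. 2.3 and Gross's `End_{W/πⁿ}(E) = O + 𝔩ⁿ⁻¹R₁` as
restated by Lauter–Viray 2015 pp. 7, 14, 17–18; Serre–Tate; Lubin–Tate uniqueness) plus elementary lemmas in the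
explicit order `O_{B,3} = ℤ₃⟨1, i, π, iπ⟩ ⊂ B = (-1,-3)_ℚ`.  This file kernel-checks ONLY the finite content of those
lemmas: the coordinate model of `(-1,-3)_ℚ` on `Fin 4 → ℚ` (associativity, relations, norm); Lemma L₀'s commutator
identity `h π − π h = 2b·iπ − 6d·i` and its valuation bookkeeping; that the six unit maps and the twists of the census
library (b50lib `MAPS`, `TWISTS`) ARE conjugation by `1, ρ, ρ², i, iρ, iρ²` (`ρ = (-1+π)/2`) resp. by `π`; Lemma G
(Gram matrix of `(1, μ₁, μ₂, μ₁μ₂)` and its determinant `-16 (d₁d₂ - x²)²`, i.e. Lauter–Viray's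
`disc = ((d₁d₂ - x²)/4)²` for the half-integral basis); Lemma X's ring identity; the `𝔽₉ = 𝔽₃[i]` facts behind
Corollary C3 (cross-type `Isom₂ = ∅`) and the camp–level law (C-a)/(C-b); the six linear solves of the fix-locus
mechanism §69.6; and the torsor-law arithmetic (T3)/(T4).  Registered checks these identities underlie: P-TORSOR
(9 833 991 + 400 057 class pairs), P-FIXLOCUS (329 + 170 discriminants), P-CAMPLEVEL (400 691 pairs), all 0 violations.
Nothing here is a statement about algebraic cycles, and no printed theorem is restated as a Lean fact.
-/

set_option linter.dupNamespace false

namespace Summit.HodgeConjecture.HodgeConjecture.HodgeLocus.Census.DictionaryLineB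

/-! ## The coordinate model of `(-1,-3)_ℚ` on the basis `1, i, π, iπ` -/

/-- Coordinate vectors w.r.t. `1, i, π, iπ`. -/
abbrev Q4 := Fin 4 → ℚ

/-- Quaternion product of `(-1,-3)_ℚ`: `i² = -1`, `π² = -3`, `π i = -i π`, `(iπ)² = -3`, `π(iπ) = 3i`, `i(iπ) = -π`. -/
def qmul (x y : Q4) : Q4 :=
  ![x 0 * y 0 - x 1 * y 1 - 3 * x 2 * y 2 - 3 * x 3 * y 3,
    x 0 * y 1 + x 1 * y 0 + 3 * x 2 * y 3 - 3 * x 3 * y 2,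
    x 0 * y 2 + x 2 * y 0 - x 1 * y 3 + x 3 * y 1,
    x 0 * y 3 + x 3 * y 0 + x 1 * y 2 - x 2 * y 1]

/-- `1`. -/
def qone : Q4 := ![1, 0, 0, 0]
/-- `i`. -/
def qi : Q4 := ![0, 1, 0, 0]
/-- `π` (`π² = -3`), a uniformiser of `O_{B,3}`. -/
def qpi : Q4 := ![0, 0, 1, 0]
/-- `iπ`. -/
def qipi : Q4 := ![0, 0, 0, 1]
/-- `ρ = (-1 + π)/2`, a unit of order `3` in `O_B^× / ±1`. -/
def rho : Q4 := ![-1/2, 0, 1/2, 0]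
/-- `ρ̄ = ρ⁻¹ = (-1 - π)/2`. -/
def rhobar : Q4 := ![-1/2, 0, -1/2, 0]
/-- The pure quaternion `X i + Y π + W iπ` (census `μ`-coordinates). -/
def pure (X Y W : ℚ) : Q4 := ![0, X, Y, W]
/-- Quaternion conjugation. -/
def qbar (x : Q4) : Q4 := ![x 0, -x 1, -x 2, -x 3]
/-- Reduced trace `Trd x = 2 x₀`. -/
def trd (x : Q4) : ℚ := 2 * x 0
/-- Reduced norm of `(-1,-3)`: `x₀² + x₁² + 3x₂² + 3x₃²` (positive definite: `B` is definite). -/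
def nrd (x : Q4) : ℚ := x 0 ^ 2 + x 1 ^ 2 + 3 * x 2 ^ 2 + 3 * x 3 ^ 2

/-- Coordinate `zero` of the product `qmul x y` (unfolding lemma for `simp`). -/
@[simp] lemma qmul_apply_zero (x y : Q4) : qmul x y 0 = x 0 * y 0 - x 1 * y 1 - 3 * x 2 * y 2 - 3 * x 3 * y 3 := rfl
/-- Coordinate `one` of the product `qmul x y` (unfolding lemma for `simp`). -/
@[simp] lemma qmul_apply_one (x y : Q4) : qmul x y 1 = x 0 * y 1 + x 1 * y 0 + 3 * x 2 * y 3 - 3 * x 3 * y 2 := rfl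
/-- Coordinate `two` of the product `qmul x y` (unfolding lemma for `simp`). -/
@[simp] lemma qmul_apply_two (x y : Q4) : qmul x y 2 = x 0 * y 2 + x 2 * y 0 - x 1 * y 3 + x 3 * y 1 := rfl
/-- Coordinate `three` of the product `qmul x y` (unfolding lemma for `simp`). -/
@[simp] lemma qmul_apply_three (x y : Q4) : qmul x y 3 = x 0 * y 3 + x 3 * y 0 + x 1 * y 2 - x 2 * y 1 := rfl
/-- Coordinate `zero` of `qone` (unfolding lemma for `simp`). -/
@[simp] lemma qone_zero : qone 0 = 1 := rfl
/-- Coordinate `one` of `qone` (unfolding lemma for `simp`). -/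
@[simp] lemma qone_one : qone 1 = 0 := rfl
/-- Coordinate `two` of `qone` (unfolding lemma for `simp`). -/
@[simp] lemma qone_two : qone 2 = 0 := rfl
/-- Coordinate `three` of `qone` (unfolding lemma for `simp`). -/
@[simp] lemma qone_three : qone 3 = 0 := rfl
/-- Coordinate `zero` of `qi` (unfolding lemma for `simp`). -/
@[simp] lemma qi_zero : qi 0 = 0 := rfl
/-- Coordinate `one` of `qi` (unfolding lemma for `simp`). -/
@[simp] lemma qi_one : qi 1 = 1 := rfl
/-- Coordinate `two` of `qi` (unfolding lemma for `simp`). -/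
@[simp] lemma qi_two : qi 2 = 0 := rfl
/-- Coordinate `three` of `qi` (unfolding lemma for `simp`). -/
@[simp] lemma qi_three : qi 3 = 0 := rfl
/-- Coordinate `zero` of `qpi` (unfolding lemma for `simp`). -/
@[simp] lemma qpi_zero : qpi 0 = 0 := rfl
/-- Coordinate `one` of `qpi` (unfolding lemma for `simp`). -/
@[simp] lemma qpi_one : qpi 1 = 0 := rfl
/-- Coordinate `two` of `qpi` (unfolding lemma for `simp`). -/
@[simp] lemma qpi_two : qpi 2 = 1 := rfl
/-- Coordinate `three` of `qpi` (unfolding lemma for `simp`). -/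
@[simp] lemma qpi_three : qpi 3 = 0 := rfl
/-- Coordinate `zero` of `qipi` (unfolding lemma for `simp`). -/
@[simp] lemma qipi_zero : qipi 0 = 0 := rfl
/-- Coordinate `one` of `qipi` (unfolding lemma for `simp`). -/
@[simp] lemma qipi_one : qipi 1 = 0 := rfl
/-- Coordinate `two` of `qipi` (unfolding lemma for `simp`). -/
@[simp] lemma qipi_two : qipi 2 = 0 := rfl
/-- Coordinate `three` of `qipi` (unfolding lemma for `simp`). -/
@[simp] lemma qipi_three : qipi 3 = 1 := rfl
/-- Coordinate `zero` of `rho` (unfolding lemma for `simp`). -/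
@[simp] lemma rho_zero : rho 0 = -1/2 := rfl
/-- Coordinate `one` of `rho` (unfolding lemma for `simp`). -/
@[simp] lemma rho_one : rho 1 = 0 := rfl
/-- Coordinate `two` of `rho` (unfolding lemma for `simp`). -/
@[simp] lemma rho_two : rho 2 = 1/2 := rfl
/-- Coordinate `three` of `rho` (unfolding lemma for `simp`). -/
@[simp] lemma rho_three : rho 3 = 0 := rfl
/-- Coordinate `zero` of `rhobar` (unfolding lemma for `simp`). -/
@[simp] lemma rhobar_zero : rhobar 0 = -1/2 := rfl
/-- Coordinate `one` of `rhobar` (unfolding lemma for `simp`). -/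
@[simp] lemma rhobar_one : rhobar 1 = 0 := rfl
/-- Coordinate `two` of `rhobar` (unfolding lemma for `simp`). -/
@[simp] lemma rhobar_two : rhobar 2 = -1/2 := rfl
/-- Coordinate `three` of `rhobar` (unfolding lemma for `simp`). -/
@[simp] lemma rhobar_three : rhobar 3 = 0 := rfl
/-- Coordinate `zero` of `pure` (unfolding lemma for `simp`). -/
@[simp] lemma pure_zero (X Y W : ℚ) : pure X Y W 0 = 0 := rfl
/-- Coordinate `one` of `pure` (unfolding lemma for `simp`). -/
@[simp] lemma pure_one (X Y W : ℚ) : pure X Y W 1 = X := rfl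
/-- Coordinate `two` of `pure` (unfolding lemma for `simp`). -/
@[simp] lemma pure_two (X Y W : ℚ) : pure X Y W 2 = Y := rfl
/-- Coordinate `three` of `pure` (unfolding lemma for `simp`). -/
@[simp] lemma pure_three (X Y W : ℚ) : pure X Y W 3 = W := rfl
/-- Coordinate `zero` of `qbar` (unfolding lemma for `simp`). -/
@[simp] lemma qbar_zero (x : Q4) : qbar x 0 = x 0 := rfl
/-- Coordinate `one` of `qbar` (unfolding lemma for `simp`). -/
@[simp] lemma qbar_one (x : Q4) : qbar x 1 = -x 1 := rfl
/-- Coordinate `two` of `qbar` (unfolding lemma for `simp`). -/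
@[simp] lemma qbar_two (x : Q4) : qbar x 2 = -x 2 := rfl
/-- Coordinate `three` of `qbar` (unfolding lemma for `simp`). -/
@[simp] lemma qbar_three (x : Q4) : qbar x 3 = -x 3 := rfl

/-- Associativity of the product (so the table is the multiplication of an algebra). -/
theorem qmul_assoc (x y z : Q4) : qmul (qmul x y) z = qmul x (qmul y z) := by
  ext k; fin_cases k <;> simp <;> ring

/-- `1` is a two-sided unit. -/
theorem qmul_one (x : Q4) : qmul x qone = x ∧ qmul qone x = x := by
  constructor <;> (ext k; fin_cases k <;> simp)

/-- Defining relations: `i² = -1`, `π² = -3`, `i·π = iπ`, `π·i = -(iπ)`. -/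
theorem relations :
    qmul qi qi = -qone ∧ qmul qpi qpi = -(3 : ℚ) • qone ∧ qmul qi qpi = qipi ∧ qmul qpi qi = -qipi := by
  refine ⟨?_, ?_, ?_, ?_⟩ <;> (ext k; fin_cases k <;> simp)

/-- `x x̄ = Nrd(x)·1` and `x + x̄ = Trd(x)·1`. -/
theorem nrd_trd (x : Q4) : qmul x (qbar x) = nrd x • qone ∧ x + qbar x = trd x • qone := by
  constructor <;> (ext k; fin_cases k <;> simp [nrd, trd] <;> ring)

/-- The reduced norm is multiplicative (so units have unit norm and `B` is a division algebra over `ℚ`). -/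
theorem nrd_mul (x y : Q4) : nrd (qmul x y) = nrd x * nrd y := by
  simp [nrd]; ring

/-- `ρ ρ̄ = 1 = ρ̄ ρ` and `ρ³ = 1`: `ρ` is a unit of order three. -/
theorem rho_unit : qmul rho rhobar = qone ∧ qmul rhobar rho = qone ∧ qmul rho (qmul rho rho) = qone := by
  refine ⟨?_, ?_, ?_⟩ <;> (ext k; fin_cases k <;> simp <;> norm_num)

/-! ## Lemma L₀: the commutator identity and the valuation bookkeeping -/

/-- For `h = a + b i + c π + d iπ`: `h π − π h = 2b·iπ − 6d·i` (coordinates `(0, -6d, 0, 2b)`).  Hence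
`v_P(h π h⁻¹ − π) = v_P(2b·iπ − 6d·i) = min(2v₃(b) + 1, 2v₃(d) + 2) = 1 + v_P(b i + d iπ)`, i.e.
`h ∈ ℤ₃[π] + Pⁿ⁻¹ ⟺ v_P(h π h⁻¹ − π) ≥ n` (DERIVATIONS §69.2, Lemma L₀). -/
theorem comm_pi (a b c d : ℚ) : qmul ![a, b, c, d] qpi - qmul qpi ![a, b, c, d] = ![0, -6 * d, 0, 2 * b] := by
  ext k; fin_cases k <;> simp <;> ring

/-- Valuation bookkeeping of Lemma L₀ (`v_P(3) = 2`, `v_P(i) = 0`, `v_P(iπ) = 1`; `β = v₃(b)`, `δ = v₃(d)`). -/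
theorem vP_bookkeeping (β δ : ℕ) : min (2 * β + 1) (2 * δ + 2) = 1 + min (2 * β) (2 * δ + 1) := by
  omega

/-! ## The census maps are unit conjugations -/

/-- Conjugation by `ρ`: `ρ (X i + Y π + W iπ) ρ⁻¹ = -(X+3W)/2 · i + Y π + (X-W)/2 · iπ` — b50lib map `_m1`. -/
theorem conj_rho (X Y W : ℚ) :
    qmul (qmul rho (pure X Y W)) rhobar = pure (-(X + 3 * W) / 2) Y ((X - W) / 2) := by
  ext k; fin_cases k <;> simp <;> ring

/-- Conjugation by `ρ² = ρ̄`: b50lib map `_m2`. -/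
theorem conj_rho_sq (X Y W : ℚ) :
    qmul (qmul rhobar (pure X Y W)) rho = pure ((-X + 3 * W) / 2) Y (-(X + W) / 2) := by
  ext k; fin_cases k <;> simp <;> ring

/-- Conjugation by `i` (`i⁻¹ = -i`): `(X, -Y, -W)` — b50lib map `_m3`. -/
theorem conj_i (X Y W : ℚ) : qmul (qmul qi (pure X Y W)) (-qi) = pure X (-Y) (-W) := by
  ext k; fin_cases k <;> simp

/-- Conjugation by `iρ`: b50lib map `_m4`. -/
theorem conj_irho (X Y W : ℚ) :
    qmul (qmul (qmul qi rho) (pure X Y W)) (qmul rhobar (-qi)) = pure (-(X + 3 * W) / 2) (-Y) (-(X - W) / 2) := by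
  ext k; fin_cases k <;> simp <;> ring

/-- Conjugation by `iρ²`: b50lib map `_m5`. -/
theorem conj_irho_sq (X Y W : ℚ) :
    qmul (qmul (qmul qi rhobar) (pure X Y W)) (qmul rho (-qi)) = pure ((-X + 3 * W) / 2) (-Y) ((X + W) / 2) := by
  ext k; fin_cases k <;> simp <;> ring

/-- The twist `σ` = conjugation by `π` (`π⁻¹ = -π/3`): `(X,Y,W) ↦ (-X, Y, -W)` — b50lib `tw_sigma`;
(`ι` is `μ ↦ -μ`, `σι` their composite `(X, -Y, W)`). -/
theorem conj_pi (X Y W : ℚ) : qmul (qmul qpi (pure X Y W)) (-(1 / 3 : ℚ) • qpi) = pure (-X) Y (-W) := by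
  ext k; fin_cases k <;> simp <;> ring

/-- A pure vector squares to the scalar `-(X² + 3Y² + 3W²) = D` (norm form of the census: `X² + 3Y² + 3W² = |D|`). -/
theorem pure_sq (X Y W : ℚ) : qmul (pure X Y W) (pure X Y W) = (-(X ^ 2 + 3 * Y ^ 2 + 3 * W ^ 2)) • qone := by
  ext k; fin_cases k <;> simp <;> ring

/-- Anticommutator of two pure vectors: `μ₁μ₂ + μ₂μ₁ = -2x·1` with `x = XX′ + 3(YY′ + WW′)` (= b50lib `trace_Q/4`
on `μ`-coordinates; the census 'trace'). -/
theorem pure_anticomm (X Y W X' Y' W' : ℚ) :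
    qmul (pure X Y W) (pure X' Y' W') + qmul (pure X' Y' W') (pure X Y W)
      = (-2 * (X * X' + 3 * (Y * Y' + W * W'))) • qone := by
  ext k; fin_cases k <;> simp <;> ring

/-! ## Lemma G: the Gram determinant (`disc R_f = ((d₁d₂ − x²)/4)²`) -/

/-- The symbolic Gram matrix of `(1, μ₁, μ₂, μ₁μ₂)` under `Trd`. -/
def gram (d₁ d₂ x : ℚ) : Matrix (Fin 4) (Fin 4) ℚ :=
  !![2, 0, 0, -2 * x; 0, 2 * d₁, -2 * x, 0; 0, -2 * x, 2 * d₂, 0; -2 * x, 0, 0, 4 * x ^ 2 - 2 * d₁ * d₂]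

/-- The Gram matrix computed in the model equals the symbolic one: with `μ₁ = pure X Y W`, `μ₂ = pure X' Y' W'`,
`d₁ = -(X²+3Y²+3W²)`, `d₂` likewise, `x = XX′+3YY′+3WW′`, every entry `Trd(b_s b_t)` is as displayed. -/
theorem gram_entries (X Y W X' Y' W' : ℚ) :
    let μ₁ := pure X Y W
    let μ₂ := pure X' Y' W'
    let b : Fin 4 → Q4 := ![qone, μ₁, μ₂, qmul μ₁ μ₂]
    (Matrix.of fun s t => trd (qmul (b s) (b t)))
      = gram (-(X ^ 2 + 3 * Y ^ 2 + 3 * W ^ 2)) (-(X' ^ 2 + 3 * Y' ^ 2 + 3 * W' ^ 2))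
          (X * X' + 3 * (Y * Y' + W * W')) := by
  ext s t; fin_cases s <;> fin_cases t <;> simp [gram, trd] <;> ring

/-- A value of `Fin.succAbove` the Laplace expansion below needs beyond the default simp set. -/
private lemma sa32 : Fin.succAbove (3 : Fin 4) (2 : Fin 3) = 2 := by decide
/-- A value of `Fin.succAbove` the Laplace expansion below needs beyond the default simp set. -/
private lemma sa22 : Fin.succAbove (2 : Fin 4) (2 : Fin 3) = 3 := by decide
/-- A value of `Fin.succAbove` the Laplace expansion below needs beyond the default simp set. -/
private lemma sa12 : Fin.succAbove (1 : Fin 4) (2 : Fin 3) = 3 := by decide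

/-- `det Gram(1, μ₁, μ₂, μ₁μ₂) = -16 (d₁d₂ − x²)²`; for the half-integral basis `(1, e₁, e₂, e₁e₂)`,
`eₖ = (dₖ + μₖ)/2` (index `16`), this is `-((d₁d₂ − x²)/4)² = -N²`, Lauter–Viray's `disc = ((d₁d₂−x²)/4)²`. -/
theorem gram_det (d₁ d₂ x : ℚ) : (gram d₁ d₂ x).det = -16 * (d₁ * d₂ - x ^ 2) ^ 2 := by
  simp [gram, Matrix.det_succ_row_zero, Fin.sum_univ_succ, Matrix.submatrix, sa32, sa22, sa12]
  ring

/-! ## Lemma X and the `𝔽₉` facts (C3, C-a, C-b) -/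

/-- Lemma X's identity in any ring: `a(a − b) + (a − b)b = a² − b²`.  (With `a² = -3`, `b² = 3`, `a, b ∈ P`:
if `v_P(a−b) ≥ 2` the left side has `v_P ≥ 3`, but `a² − b² = -6` has `v_P = 2`; so `v_P(a − b) = 1`.) -/
theorem sq_sub_sq {R : Type*} [Ring R] (a b : R) : a * (a - b) + (a - b) * b = a * a - b * b := by
  noncomm_ring

/-- `𝔽₉ = 𝔽₃[i]` on coordinate pairs: product. -/
def mul9 (p q : ZMod 3 × ZMod 3) : ZMod 3 × ZMod 3 := (p.1 * q.1 - p.2 * q.2, p.1 * q.2 + p.2 * q.1)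
/-- Frobenius `z ↦ z³ = z̄` (`= conjugation by π` on `O_B/P`). -/
def frob (p : ZMod 3 × ZMod 3) : ZMod 3 × ZMod 3 := (p.1, -p.2)
/-- Norm `N(z) = z z̄ = a² + b²` (`z⁴ = N(z)` as an element of `𝔽₃ ⊂ 𝔽₉`). -/
def norm9 (p : ZMod 3 × ZMod 3) : ZMod 3 := p.1 * p.1 + p.2 * p.2
/-- Trace `Tr(z) = z + z̄ = 2a`. -/
def tr9 (p : ZMod 3 × ZMod 3) : ZMod 3 := p.1 + p.1

/-- `z⁴ = N(z)·1` in `𝔽₉` (so `N(z) = 1 ⟺ z⁴ = 1`, `N(z) = -1 ⟺ z⁴ = -1`). -/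
theorem pow_four_eq_norm : ∀ z : ZMod 3 × ZMod 3, mul9 (mul9 z z) (mul9 z z) = (norm9 z, 0) := by decide

/-- The norm is multiplicative and Frobenius-invariant. -/
theorem norm9_mul : ∀ z w : ZMod 3 × ZMod 3, norm9 (mul9 z w) = norm9 z * norm9 w ∧ norm9 (frob z) = norm9 z := by
  decide

/-- Leading coefficients: `μ̃ ≡ zπ (mod P²)` with `(zπ)² = -3N(z)`; `ζ₃`-type (`μ̃² = -3`) has `N(z) = 1`, i.e.
`z ∈ {±1 (REAL), ±i (IMAG)}`; `√3`-type (`μ̃² = 3`) has `N(z) = -1 = 2`, four values, none in `𝔽₃`, none equal to `±1, ±i`. -/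
theorem norm_one_classification : ∀ z : ZMod 3 × ZMod 3,
    (norm9 z = 1 ↔ (z = (1, 0) ∨ z = (-1, 0) ∨ z = (0, 1) ∨ z = (0, -1))) ∧
    (norm9 z = 2 ↔ (z = (1, 1) ∨ z = (1, -1) ∨ z = (-1, 1) ∨ z = (-1, -1))) := by
  decide

/-- Corollary C3 (cross-type `Isom_{A/μ²} = ∅`): if `N(z_a) = 1` and `N(z_b) = -1` then `ȳ = frob(z_a · z_b⁻¹)` has
norm `-1`, hence `ȳ⁴ = -1 ≠ 1` and `ȳ ∉ {±1, ±i}` — contradicting the Lie-algebra constraint `θ(ȳ) ∈ {±i}`.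
Stated divisor-free: any `y` with `y · z_b = z_a` has `N(y) = 2` and is none of `±1, ±i`. -/
theorem cross_type_obstruction : ∀ za zb y : ZMod 3 × ZMod 3, norm9 za = 1 → norm9 zb = 2 → mul9 y zb = za →
    norm9 (frob y) = 2 ∧ frob y ≠ (1, 0) ∧ frob y ≠ (-1, 0) ∧ frob y ≠ (0, 1) ∧ frob y ≠ (0, -1) := by
  decide

/-- (C-a): a unit residue `γ₀ ∈ O_B^×/(1+P) ⊂ {N = 1} = {±1, ±i}` multiplies the leading coefficient by
`γ₀/γ̄₀ = γ₀²/N(γ₀) = γ₀²  ∈ {+1, -1}`: `+1` for `γ₀ = ±1` (`γ ∈ C₃`), `-1` for `γ₀ = ±i` (`γ ∈ iC₃`). -/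
theorem unit_residue_twist : ∀ g : ZMod 3 × ZMod 3, norm9 g = 1 →
    mul9 g (frob g) = (1, 0) ∧ (mul9 g g = (1, 0) ↔ g.2 = 0) ∧ (mul9 g g = (-1, 0) ↔ g.1 = 0) := by
  decide

/-- (C-b), step 1: trace-free elements of `𝔽₉` are the line `𝔽₃·i`; `u := z̄ − z` is trace-free, and non-zero
iff `z ∉ 𝔽₃`. -/
theorem trace_free_line : ∀ z : ZMod 3 × ZMod 3,
    (tr9 z = 0 ↔ z.1 = 0) ∧ tr9 (frob z - z) = 0 ∧ (frob z - z ≠ 0 ↔ z.2 ≠ 0) := by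
  decide

/-- (C-b), step 2: for trace-free `w₀` and non-zero trace-free `u`, EXACTLY ONE of `w₀, w₀ + u, w₀ − u` vanishes
(so exactly one of `γ, γρ, γρ²` reaches level `≥ 3`). -/
theorem exactly_one_of_three : ∀ w u : ZMod 3 × ZMod 3, tr9 w = 0 → tr9 u = 0 → u ≠ 0 →
    ((w = 0 ∧ w + u ≠ 0 ∧ w - u ≠ 0) ∨ (w ≠ 0 ∧ w + u = 0 ∧ w - u ≠ 0) ∨ (w ≠ 0 ∧ w + u ≠ 0 ∧ w - u = 0)) := by
  decide

/-- (C-b), the twisted anticommutator in the model: for `z′ = a′ + b′i`, `w = a + bi` (elements of `ℚ(i) ⊂ B`),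
`(z′π) w + w (z′π) = z′ (w̄ + w) π` — so `b c₀ + c₀ b ≡ 3 z′ Tr(w₀) π (mod P⁴)` forces `Tr(w₀) = 0`. -/
theorem twisted_anticomm (a' b' a b : ℚ) :
    qmul (qmul ![a', b', 0, 0] qpi) ![a, b, 0, 0] + qmul ![a, b, 0, 0] (qmul ![a', b', 0, 0] qpi)
      = qmul (qmul ![a', b', 0, 0] (![a, b, 0, 0] + qbar ![a, b, 0, 0])) qpi := by
  ext k; fin_cases k <;> simp [qbar] <;> ring

/-- (C-b), the commutator `[π, zπ] = (z̄ − z) π²` for `z = a + bi ∈ ℚ(i)` (so `δ₁ = [ρ, μ̃]ρ⁻¹ ≡ 3(z̄ − z)` shifts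
the level-two coefficient by `u = z̄ − z`). -/
theorem comm_pi_zpi (a b : ℚ) :
    qmul qpi (qmul ![a, b, 0, 0] qpi) - qmul (qmul ![a, b, 0, 0] qpi) qpi
      = qmul (qbar ![a, b, 0, 0] - ![a, b, 0, 0]) (qmul qpi qpi) := by
  ext k; fin_cases k <;> simp [qbar]
  ring

/-- `π z = z̄ π` for `z ∈ ℚ(i)`: conjugation by `π` is complex conjugation on `ℚ₉ = ℚ₃(i)` (Frobenius on `𝔽₉`). -/
theorem pi_twist (a b : ℚ) : qmul qpi ![a, b, 0, 0] = qmul (qbar ![a, b, 0, 0]) qpi := by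
  ext k; fin_cases k <;> simp [qbar]

/-! ## §69.6: the fix-locus mechanism — six linear solves in doubled coordinates -/

/-- `σι(v) = ρ·v` is impossible: `(-(X+3W)/2, Y, (X−W)/2) = (X, −Y, W)` forces `v = 0`. -/
theorem sigiota_rho (X Y W : ℤ) (h : -(X + 3 * W) = 2 * X ∧ Y = -Y ∧ X - W = 2 * W) : X = 0 ∧ Y = 0 ∧ W = 0 := by
  omega

/-- `σι(v) = ρ²·v` is impossible. -/
theorem sigiota_rho_sq (X Y W : ℤ) (h : -X + 3 * W = 2 * X ∧ Y = -Y ∧ -(X + W) = 2 * W) :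
    X = 0 ∧ Y = 0 ∧ W = 0 := by
  omega

/-- `σι(v) = v ⟺ Y = 0`; `σι(v) = i·v ⟺ W = 0`. -/
theorem sigiota_one_i (Y W : ℤ) : (Y = -Y ↔ Y = 0) ∧ ((-Y = -Y ∧ -W = W) ↔ W = 0) := by
  omega

/-- `σι(v) = iρ·v ⟺ X = −W` (the `Y`-entries `−Y = −Y` agree automatically). -/
theorem sigiota_irho (X W : ℤ) : (-(X + 3 * W) = 2 * X ∧ -(X - W) = 2 * W) ↔ X = -W := by
  omega

/-- `σι(v) = iρ²·v ⟺ X = W`. -/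
theorem sigiota_irho_sq (X W : ℤ) : (-X + 3 * W = 2 * X ∧ X + W = 2 * W) ↔ X = W := by
  omega

/-- `ι(v) = γ·v`: `γ = 1` or `i` force `X = 0`; `γ = ρ, ρ²` force `v = 0`; `γ = iρ ⟺ X = 3W`; `γ = iρ² ⟺ X = −3W`. -/
theorem iota_cases (X Y W : ℤ) :
    ((X = -X) → X = 0) ∧
    ((-(X + 3 * W) = -(2 * X) ∧ Y = -Y ∧ X - W = -(2 * W)) → (X = 0 ∧ Y = 0 ∧ W = 0)) ∧
    ((-X + 3 * W = -(2 * X) ∧ Y = -Y ∧ -(X + W) = -(2 * W)) → (X = 0 ∧ Y = 0 ∧ W = 0)) ∧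
    ((-(X + 3 * W) = -(2 * X) ∧ -(X - W) = -(2 * W)) ↔ X = 3 * W) ∧
    ((-X + 3 * W = -(2 * X) ∧ X + W = -(2 * W)) ↔ X = -3 * W) := by
  omega

/-- `σ(v) = γ·v`: `γ = 1` forces `X = W = 0`, `γ = i` forces `X = Y = 0`, `γ = ρ, ρ²` force `X = W = 0`;
`γ = iρ ⟺ (Y = 0 ∧ X = 3W)`, `γ = iρ² ⟺ (Y = 0 ∧ X = −3W)`; and then the norm form gives `4|D| = 12W²`,
i.e. `|D| = 3W²`, fundamental only for `|D| ∈ {3, 12}` — so `Fix(σ) = ∅` for `|D| > 12`. -/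
theorem sigma_cases (X Y W : ℤ) :
    ((-X = X ∧ -W = W) → (X = 0 ∧ W = 0)) ∧
    ((-X = X ∧ Y = -Y) → (X = 0 ∧ Y = 0)) ∧
    ((-(X + 3 * W) = -(2 * X) ∧ X - W = -(2 * W)) → (X = 0 ∧ W = 0)) ∧
    ((-X + 3 * W = -(2 * X) ∧ -(X + W) = -(2 * W)) → (X = 0 ∧ W = 0)) ∧
    ((-(X + 3 * W) = -(2 * X) ∧ -Y = Y ∧ -(X - W) = -(2 * W)) ↔ (Y = 0 ∧ X = 3 * W)) ∧
    ((-X + 3 * W = -(2 * X) ∧ -Y = Y ∧ X + W = -(2 * W)) ↔ (Y = 0 ∧ X = -3 * W)) := by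
  omega

/-- The norm form on a `σ`-fixed candidate: `X = ±3W`, `Y = 0` gives `X² + 3Y² + 3W² = 12W²`. -/
theorem sigma_norm (W : ℤ) : (3 * W) ^ 2 + 3 * 0 ^ 2 + 3 * W ^ 2 = 12 * W ^ 2 ∧
    (-3 * W) ^ 2 + 3 * 0 ^ 2 + 3 * W ^ 2 = 12 * W ^ 2 := by
  constructor <;> ring

/-- (F1)'s parity facts: `a ≡ b (mod 2) ⟹ 4 ∣ a² + 3b²` (so `a² + 3b² = q` with `a ≡ b (2)` needs `4 ∣ q`), and
`W² + Y² ≡ d (mod 4)` with `d` odd forces opposite parities. -/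
theorem parity_facts : (∀ a b : ZMod 4, 2 * (a - b) = 0 → a * a + 3 * (b * b) = 0) ∧
    (∀ a b : ZMod 4, (a * a + b * b = 1 ∨ a * a + b * b = 3) → 2 * (a - b) ≠ 0) := by
  decide

/-! ## (T3)/(T4): the torsor-law arithmetic -/

/-- The pair sum of levels predicted by the torsor law: `S = 6` if `ℓ_max = 1`, else
`3 + 3·min(ℓ_max, ω_min + 1) + (ℓ_max − ω_min − 1)⁺` (truncated subtraction on `ℕ`). -/
def S (lmax omin : ℕ) : ℕ := if lmax ≤ 1 then 6 else 3 + 3 * min lmax (omin + 1) + (lmax - (omin + 1))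

/-- (T3): `S ∉ {7, 8}` — with GZ-SHAPE `v₃(j − j′) = S/2`, no two same-type singular moduli are at `3`-adic
distance strictly between `3` and `9/2` (`ω_min ≥ 1` always). -/
theorem S_not_7_8 (lmax omin : ℕ) (hω : 1 ≤ omin) : S lmax omin ≠ 7 ∧ S lmax omin ≠ 8 := by
  unfold S; split_ifs <;> omega

/-- (T4): ENGINE A's inferred horizon map is the torsor law read on self-pairs.  With `w = 3ω + 3` and `d = S(H, ω)`
(`H ≥ 2`): if `H ≤ ω + 1` then `d = 3H + 3 ≤ w + 3·0 + …` and `H = d/3 − 1`; if `H ≥ ω + 2` then `d = H + 2ω + 5 ≥ w + 4`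
and `H = d − w + ω − 2`. -/
theorem horizon_map (H ω : ℕ) (hH : 2 ≤ H) :
    (H ≤ ω + 1 → (S H ω = 3 * H + 3 ∧ S H ω ≤ 3 * ω + 6 ∧ 3 ∣ S H ω ∧ H = S H ω / 3 - 1)) ∧
    (ω + 2 ≤ H → (S H ω = H + 2 * ω + 5 ∧ 3 * ω + 7 ≤ S H ω ∧ H = S H ω - (3 * ω + 3) + ω - 2)) := by
  unfold S; constructor <;> intro h <;> split_ifs <;> omega

end Summit.HodgeConjecture.HodgeConjecture.HodgeLocus.Census.DictionaryLineB
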